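import Summits.Ventures.QEC.Thresholds.PlanarSurfaceCodePhenomSAWBox
import Literature.InformationTheory.QuantumCodes.PlanarCodeDrawing
import Literature.InformationTheory.QuantumCodes.DrawnCheckMatrixReindex
import HarnessLib
-- buildfix (bf3-g30) G30-29: comment-only touch to re-dispatch the lane build (dead-lettered rc 76 (att 7, last 20:24 08-27 / 06:01 08-28) behind Literature.InformationTheory.QuantumCodes.ToricCodeErasureHalfGeometry whose hub olean is fresh; root and file farm rc 0 now (lane datum: host-local stale dependency olean); no build event for 9-19 h); declarations byte-identical

/-!
# Planar surface codes under INHOMOGENEOUS space-time noise, `H_Z` record (bit flips, noisy `Z`-syndrome) by RE-INDEXING the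
# `H_X` drawing along the planar self-duality: failure sums `→ 0` for all rates `≤ ρ < p₀(4.7476)`; both records together

Venture QEC, `Summits/Ventures/QEC/Thresholds/` (LADDER-QEC rung Q5, PARTITION row 09 "phenomenological"; qec-type-09 gen 7, line
D50.L6 «L-PHENOM», planar companion, second record). `PlanarSurfaceCodePhenomSAWInhomogeneous.lean` (not imported) treats the `H_X` record through
the drawing `planarDrawing k` (`PlanarCodeDrawing.lean`). The `Z`-checks of the planar code ARE the re-indexed `X`-checks
(`planarHZ_eq_reindex_planarHX`, gen 6), so the generic transport `CheckDrawing.reindex` / `CheckDrawing.ofEq`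
(`DrawnCheckMatrixReindex.lean`) yields a drawing of `planarHZ k` with the same sites and rough edges; its bottom crossing number
is the number of LEFT-column qubits `(α, 0)_L`, odd on every non-trivial `X`-logical by the self-duality
(`planar_bottomCrossing_eq_one` pulled back, `planar_mem_planarSX_iff_comp_mem`).

| theorem | statement | tier |
|---|---|---|
| `planarDrawingZ`, `planarDrawingZ_heightGap`, `sum_mul_planarDrawingZ_bot`, `planar_phenomZ_oddResidual_bot` | the `H_Z` drawing (definition); height gap `k+2`; `Σ_q c(q)·bot(q) = Σ_α c((α,0)_L)`; failure ⇒ odd | CERTIFIED (kernel) |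
| `planar_stZ_sum_indepWeight_oddResidual_le`, `planar_stZ_tendsto_sum_indepWeight_oddResidual` | inhomogeneous rates `≤ ρ ≤ 1/2`, `cₙ(ℤ³) ≤ C νⁿ`: `Σ_{odd} w_r ≤ (k+2)·T·C·r^{k+2}/(1-r)`; `→ 0` for poly rounds when `4ν² ρ(1-ρ) < 1` | CERTIFIED (kernel), parametric |
| ★ `planar_stInhom_belowThreshold'_kernelZ3SymmK12`, `planar_stInhom_belowThreshold'_0112` | `H_Z` record: all rates `≤ ρ < p₀(4.7476)` (in particular `≤ .0112`) ⇒ failure sums `→ 0`; with the `H_X` file this covers both records (that file is not imported here, so that this one depends on built modules only) | CERTIFIED (kernel), unconditional |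

HONEST FRAMING. Failure-SUM statements under a rate field bounded by `ρ`, sector-wise minimum-weight space-time decoding;
decimals from the kernel certificate `μ(ℤ³) ≤ 4.7476`. No `native_decide`, no named fact.

## References

* [DennisEtAl2002] E. Dennis, A. Kitaev, A. Landahl, J. Preskill, *Topological quantum memory*, J. Math. Phys. 43 (2002)
  4452–4505, arXiv:quant-ph/0110143, §4.1 (X and Z errors on the dual lattice), §4.2, §5.2 eq. (28), §5.3 eqs. (saw_3),
  (threshold_iso), (threshold_iso_num).
* [LinPryadko2024] H.-K. Lin, L. P. Pryadko, PRA 109 (2024) 022407, §4.2 Thm 6 (permutation-equivalent codes).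
* [TillichZemor2014] J.-P. Tillich, G. Zémor, IEEE Trans. IT 60 (2014) 1193, §3 (the planar code as HGP(H, Hᵀ)).
* [PonitzTittmann2000] Electron. J. Combin. 7 (2000) R21, Table 2 (`d = 3, k = 12`).
-/

noncomputable section

namespace Summit.Ventures.QEC.Thresholds

open Filter Topology Finset Matrix
open Literature.InformationTheory.QuantumCodes
open Literature.InformationTheory.QuantumCodes.PlanarCode
open Literature.InformationTheory.QuantumCodes.ToricCode (SAWCountBound3 IsPolyBounded)
open Literature.Probability.RandomPlanarGeometry

/-! ### The `H_Z` drawing by re-indexing -/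

/-- **The `H_Z` sector of the `k`-th planar code drawn on `ℤ²`**: the `H_X` drawing re-indexed along the planar self-duality
(`planarCheckSwap`, `planarQubitSwap`) and transported along `planarHZ_eq_reindex_planarHX` (definition).
[cite: LinPryadko2024, §4.2 Thm 6] [cite: TillichZemor2014, §3] -/
def planarDrawingZ (k : ℕ) : CheckDrawing (planarHZ k) 2 (Fin (k + 2)) (Fin (k + 2)) :=
  ((planarDrawing k).reindex (planarCheckSwap k) (planarQubitSwap k)).ofEq (planarHZ_eq_reindex_planarHX k)

/-- The height gap `k + 2` of the re-indexed drawing. [cite: DennisEtAl2002, §5.2 ("at least L links")] -/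
theorem planarDrawingZ_heightGap (k : ℕ) : (planarDrawingZ k).HeightGap (k + 2) :=
  CheckDrawing.ofEq_heightGap _ _ (CheckDrawing.reindex_heightGap _ _ _ (planarDrawing_heightGap k))

/-- **The bottom crossing number of the `H_Z` drawing is the number of left-column qubits `(α, 0)_L`.**
[cite: DennisEtAl2002, §3.2 (a relative cycle of the dual lattice crosses the smooth edge)] -/
theorem sum_mul_planarDrawingZ_bot {k : ℕ} (c : PlanarQubit k → ZMod 2) :
    ∑ q, c q * (planarDrawingZ k).bot q = ∑ b : Fin (k + 2), c (planarQubitSwap k (Sum.inl (0, b))) := by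
  unfold planarDrawingZ
  rw [CheckDrawing.sum_mul_bot_ofEq, CheckDrawing.sum_mul_bot_reindex, sum_mul_planarDrawing_bot]

/-- **Failure of the `H_Z`-record memory experiment ⇒ odd bottom crossing for the `H_Z` drawing**: the projected residual of a
minimum-weight space-time decoder that fails is a non-trivial `X`-logical; pulled back along the self-duality it is a
non-trivial `Z`-logical, which crosses the bottom rough edge an odd number of times (`planar_bottomCrossing_eq_one`).
[cite: DennisEtAl2002, §4.3 (success iff the residual is homologically trivial) and §4.1 (the dual lattice)] [cite: LinPryadko2024, §4.2 Thm 6] -/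
theorem planar_phenomZ_oddResidual_bot (k T : ℕ) {D : CSSPhenom.STDecoder (PlanarZCheck k) (PlanarQubit k) T}
    (hD : D.IsMinWeight (CSSPhenom.stSyn (planarHZ k) T) (CSSPhenom.stCycles (planarHZ k) T) hammingNorm)
    {E : CSSPhenom.History (PlanarZCheck k) (PlanarQubit k) T}
    (hfail : ¬ D.Corrects (CSSPhenom.stSyn (planarHZ k) T)
      (CSSPhenom.stTrivial (planarSX k : Set (PlanarQubit k → ZMod 2)) T) E) :
    ∑ q, CSSPhenom.proj (D (CSSPhenom.stSyn (planarHZ k) T E) + E) q * (planarDrawingZ k).bot q = 1 := by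
  rw [sum_mul_planarDrawingZ_bot]
  set R := CSSPhenom.proj (D (CSSPhenom.stSyn (planarHZ k) T E) + E) with hR
  have hc : CSSPhenom.stMatrix (planarHZ k) T *ᵥ (D (CSSPhenom.stSyn (planarHZ k) T E) + E) = 0 := hD.add_mem E
  have hker : planarHZ k *ᵥ R = 0 := CSSPhenom.mulVec_proj_eq_zero hc
  have hnot : R ∉ (planarSX k : Set (PlanarQubit k → ZMod 2)) := hfail
  have hker' : planarHX k *ᵥ (R ∘ ⇑(planarQubitSwap k)) = 0 := by
    rw [planarHZ_eq_reindex_planarHX, Matrix.reindex_apply, Matrix.submatrix_mulVec_equiv, Equiv.symm_symm] at hker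
    funext x
    have h1 := congrFun hker (planarCheckSwap k x)
    simpa using h1
  have hnot' : R ∘ ⇑(planarQubitSwap k) ∉ (planarSZ k : Set (PlanarQubit k → ZMod 2)) :=
    fun h => hnot ((planar_mem_planarSX_iff_comp_mem k R).2 h)
  exact planar_bottomCrossing_eq_one k hker' hnot'

/-! ### The inhomogeneous space-time bound for the `H_Z` record -/

open Classical in
/-- **Inhomogeneous space-time counting bound, `H_Z` record of the planar code** (`T` rounds, rates `0 ≤ r_ℓ ≤ ρ ≤ 1/2`,
minimum-weight space-time decoder, `cₙ(ℤ³) ≤ C νⁿ`, `r = 2ν√(ρ(1-ρ)) < 1`):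
`Σ_{E : odd-crossing projected residual} w_r(E) ≤ (k+2)·T·C·r^{k+2}/(1-r)`. [cite: DennisEtAl2002, §5.2 eq. (28), §5.3 eqs. (saw_3), (fail_iso)] -/
theorem planar_stZ_sum_indepWeight_oddResidual_le {k : ℕ} {C ν : ℝ} (hν : 0 < ν) (hC : SAWCountBound3 C ν) {T : ℕ}
    {D : CSSPhenom.STDecoder (PlanarZCheck k) (PlanarQubit k) T}
    (hD : D.IsMinWeight (CSSPhenom.stSyn (planarHZ k) T) (CSSPhenom.stCycles (planarHZ k) T) hammingNorm)
    {r : HistoryLoc (PlanarQubit k) (PlanarZCheck k) T → ℝ} {ρ : ℝ} (hr0 : ∀ ℓ, 0 ≤ r ℓ) (hrρ : ∀ ℓ, r ℓ ≤ ρ)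
    (hρ : ρ ≤ 1 / 2) (hr1 : 2 * ν * Real.sqrt (ρ * (1 - ρ)) < 1) :
    ∑ E ∈ univ.filter (fun E : CSSPhenom.History (PlanarZCheck k) (PlanarQubit k) T =>
        ∑ q, CSSPhenom.proj (D (CSSPhenom.stSyn (planarHZ k) T E) + E) q * (planarDrawingZ k).bot q = 1),
        indepWeight r (supp E) ≤
      ((k : ℝ) + 2) * T * C * (2 * ν * Real.sqrt (ρ * (1 - ρ))) ^ (k + 2) / (1 - 2 * ν * Real.sqrt (ρ * (1 - ρ))) := by
  classical
  have h := ((planarDrawingZ k).spaceTime T).sum_indepWeight_oddResidual_le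
    ((planarDrawingZ k).spaceTime_heightGap T (planarDrawingZ_heightGap k)) hν hC (D := D) hD hr0 hrρ hρ hr1
  rw [Fintype.card_prod, Fintype.card_fin, Fintype.card_fin, Nat.cast_mul] at h
  push_cast at h
  refine le_trans (le_of_eq (Finset.sum_congr (Finset.filter_congr fun E _ => ?_) fun _ _ => rfl)) h
  rw [CheckDrawing.sum_mul_bot_spaceTime]
  exact Iff.rfl

open Classical in
/-- **`H_Z` record, inhomogeneous space-time noise: failure sums `→ 0` when `4ν² ρ(1-ρ) < 1`** (`cₙ(ℤ³) ≤ C νⁿ`, polynomially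
many rounds, every family of minimum-weight space-time decoders of the `Z`-check record, every family of rate fields `≤ ρ`).
[cite: DennisEtAl2002, §5.3 eq. (threshold_iso) with §5.2 eq. (28)] -/
theorem planar_stInhom_belowThreshold'_of_sawCountBound3 {C ν : ℝ} (hν : 0 < ν) (hC : SAWCountBound3 C ν) {T : ℕ → ℕ}
    (hT : IsPolyBounded T) (D : ∀ k, CSSPhenom.STDecoder (PlanarZCheck k) (PlanarQubit k) (T k))
    (hD : ∀ k, (D k).IsMinWeight (CSSPhenom.stSyn (planarHZ k) (T k)) (CSSPhenom.stCycles (planarHZ k) (T k)) hammingNorm)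
    (r : ∀ k, HistoryLoc (PlanarQubit k) (PlanarZCheck k) (T k) → ℝ) {ρ : ℝ} (hρ0 : 0 ≤ ρ) (hr0 : ∀ k ℓ, 0 ≤ r k ℓ)
    (hrρ : ∀ k ℓ, r k ℓ ≤ ρ) (hρ : ρ ≤ 1 / 2) (h4 : 4 * ν ^ 2 * (ρ * (1 - ρ)) < 1) :
    Tendsto (fun k => ∑ E ∈ univ.filter (fun E : CSSPhenom.History (PlanarZCheck k) (PlanarQubit k) (T k) =>
        ¬ (D k).Corrects (CSSPhenom.stSyn (planarHZ k) (T k))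
          (CSSPhenom.stTrivial (planarSX k : Set (PlanarQubit k → ZMod 2)) (T k)) E),
        indepWeight (r k) (supp E)) atTop (𝓝 0) := by
  set s := Real.sqrt (ρ * (1 - ρ)) with hs
  set r' := 2 * ν * s with hr
  have hs0 : 0 ≤ s := Real.sqrt_nonneg _
  have hr0' : 0 ≤ r' := by rw [hr]; positivity
  have hpp : 0 ≤ ρ * (1 - ρ) := mul_nonneg hρ0 (by linarith)
  have hr1 : r' < 1 := by
    have hsq : r' ^ 2 = 4 * ν ^ 2 * (ρ * (1 - ρ)) := by
      rw [hr, mul_pow, mul_pow, hs, Real.sq_sqrt hpp]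
      ring
    have h : r' ^ 2 < 1 := by rw [hsq]; exact h4
    have := (sq_lt_one_iff_abs_lt_one r').1 h
    rwa [abs_of_nonneg hr0'] at this
  have h1r : 0 < 1 - r' := by linarith
  have hC0 : 0 ≤ C := by
    have h0 := hC 0
    rw [SAW.Zd.count_zero, pow_zero, mul_one, Nat.cast_one] at h0
    linarith
  have hw : ∀ k E, 0 ≤ indepWeight (r k) (supp E) := fun k E =>
    indepWeight_nonneg (hr0 k) (fun ℓ => (hrρ k ℓ).trans (by linarith)) _
  refine CheckDrawing.tendsto_of_le_linear_polyRounds_geometric hT (K := 2 * C * r' / (1 - r')) (by positivity) hr0' hr1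
    (fun k => Finset.sum_nonneg fun E _ => hw k E) fun k => ?_
  have hsub : (∑ E ∈ univ.filter (fun E : CSSPhenom.History (PlanarZCheck k) (PlanarQubit k) (T k) =>
        ¬ (D k).Corrects (CSSPhenom.stSyn (planarHZ k) (T k))
          (CSSPhenom.stTrivial (planarSX k : Set (PlanarQubit k → ZMod 2)) (T k)) E),
        indepWeight (r k) (supp E)) ≤
      ∑ E ∈ univ.filter (fun E : CSSPhenom.History (PlanarZCheck k) (PlanarQubit k) (T k) =>
        ∑ q, CSSPhenom.proj (D k (CSSPhenom.stSyn (planarHZ k) (T k) E) + E) q * (planarDrawingZ k).bot q = 1),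
        indepWeight (r k) (supp E) := by
    refine Finset.sum_le_sum_of_subset_of_nonneg (fun E hE => ?_) fun E _ _ => hw k E
    rw [Finset.mem_filter] at hE ⊢
    exact ⟨Finset.mem_univ _, planar_phenomZ_oddResidual_bot k (T k) (hD k) hE.2⟩
  refine hsub.trans ((planar_stZ_sum_indepWeight_oddResidual_le hν hC (hD k) (hr0 k) (hrρ k) hρ hr1).trans ?_)
  rw [← hs, ← hr]
  have hk2 : (k : ℝ) + 2 ≤ 2 * ((k + 1 : ℕ) : ℝ) := by push_cast; linarith [(Nat.cast_nonneg k : (0 : ℝ) ≤ k)]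
  have hX : 0 ≤ (T k : ℝ) * C * r' ^ (k + 2) / (1 - r') := by positivity
  calc ((k : ℝ) + 2) * (T k) * C * r' ^ (k + 2) / (1 - r')
      = ((k : ℝ) + 2) * ((T k : ℝ) * C * r' ^ (k + 2) / (1 - r')) := by ring
    _ ≤ 2 * ((k + 1 : ℕ) : ℝ) * ((T k : ℝ) * C * r' ^ (k + 2) / (1 - r')) := mul_le_mul_of_nonneg_right hk2 hX
    _ = ((k + 1 : ℕ) : ℝ) * (T k) * (2 * C * r' / (1 - r')) * r' ^ (k + 1) := by ring

open Classical in
/-- ★ **`H_Z` record of the planar codes: all space-time fault rates `≤ ρ < p₀(4.7476)` ⇒ failure sums `→ 0`** (every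
polynomially bounded schedule, every minimum-weight space-time decoder family, every rate field) — UNCONDITIONAL, tier CERTIFIED
(kernel). [cite: DennisEtAl2002, §5.3 eq. (threshold_iso_num)] [cite: PonitzTittmann2000, Table 2 (d = 3, k = 12)] -/
theorem planar_stInhom_belowThreshold'_kernelZ3SymmK12 {T : ℕ → ℕ} (hT : IsPolyBounded T)
    (D : ∀ k, CSSPhenom.STDecoder (PlanarZCheck k) (PlanarQubit k) (T k))
    (hD : ∀ k, (D k).IsMinWeight (CSSPhenom.stSyn (planarHZ k) (T k)) (CSSPhenom.stCycles (planarHZ k) (T k)) hammingNorm)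
    (r : ∀ k, HistoryLoc (PlanarQubit k) (PlanarZCheck k) (T k) → ℝ) {ρ : ℝ} (hρ0 : 0 ≤ ρ) (hr0 : ∀ k ℓ, 0 ≤ r k ℓ)
    (hrρ : ∀ k ℓ, r k ℓ ≤ ρ) (hρ : ρ < thresholdValue 4.7476) :
    Tendsto (fun k => ∑ E ∈ univ.filter (fun E : CSSPhenom.History (PlanarZCheck k) (PlanarQubit k) (T k) =>
        ¬ (D k).Corrects (CSSPhenom.stSyn (planarHZ k) (T k))
          (CSSPhenom.stTrivial (planarSX k : Set (PlanarQubit k → ZMod 2)) (T k)) E),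
        indepWeight (r k) (supp E)) atTop (𝓝 0) := by
  have hρh : ρ ≤ 1 / 2 := hρ.le.trans (thresholdValue_le_half _)
  obtain ⟨ν, hν, h4⟩ := exists_gt_four_mul_sq_lt_one_of_lt_thresholdValue (by norm_num) hρ0 hρ
  obtain ⟨C, hC⟩ := exists_sawCountBound3_of_connectiveConstant_lt
    (lt_of_le_of_lt SAW.Zd.FiniteMemory3.connectiveConstant_three_le_47476 hν)
  exact planar_stInhom_belowThreshold'_of_sawCountBound3 (by linarith) hC hT D hD r hρ0 hr0 hrρ hρh h4


open Classical in
/-- **Decimal, `H_Z` record**: all space-time fault rates in `[0, .0112]` ⇒ the failure sums of the planar memory experiment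
(`Z`-check record) tend to `0` — UNCONDITIONAL, tier CERTIFIED (kernel); with `planar_stInhom_belowThreshold_0112`
(`PlanarSurfaceCodePhenomSAWInhomogeneous.lean`, not imported here) this covers BOTH records.
[cite: DennisEtAl2002, §4.1 (X and Z errors corrected separately) and §5.3 eq. (threshold_iso_num)] -/
theorem planar_stInhom_belowThreshold'_0112 {T : ℕ → ℕ} (hT : IsPolyBounded T)
    (DX : ∀ k, CSSPhenom.STDecoder (PlanarZCheck k) (PlanarQubit k) (T k))
    (hDX : ∀ k, (DX k).IsMinWeight (CSSPhenom.stSyn (planarHZ k) (T k)) (CSSPhenom.stCycles (planarHZ k) (T k))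
      hammingNorm)
    (rX : ∀ k, HistoryLoc (PlanarQubit k) (PlanarZCheck k) (T k) → ℝ)
    (hrX0 : ∀ k ℓ, 0 ≤ rX k ℓ) (hrX : ∀ k ℓ, rX k ℓ ≤ 0.0112) :
    Tendsto (fun k => ∑ E ∈ univ.filter (fun E : CSSPhenom.History (PlanarZCheck k) (PlanarQubit k) (T k) =>
        ¬ (DX k).Corrects (CSSPhenom.stSyn (planarHZ k) (T k))
          (CSSPhenom.stTrivial (planarSX k : Set (PlanarQubit k → ZMod 2)) (T k)) E),
        indepWeight (rX k) (supp E)) atTop (𝓝 0) := by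
  have h := thresholdValue_47476_bounds.1
  exact planar_stInhom_belowThreshold'_kernelZ3SymmK12 hT DX hDX rX (by norm_num) hrX0 hrX (by linarith)

end Summit.Ventures.QEC.Thresholds
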